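import Summits.AtomisticToContinuum.BoseEinsteinCondensation.Theses.BECStoquasticCensoring
import Literature.MathematicalPhysics.QuantumManyBody.PeriodicBoseGasScattering
import Literature.MathematicalPhysics.QuantumManyBody.BoseGasThermodynamicLimitRuelle

/-!
# Route `BECStoquasticCensoring`, support item `ScatteringLengthPos` (stmt-AtomisticToContinuum-11479)

For every repulsive finite-range pair potential `v : ℝ → ℝ≥0∞` (hard cores allowed):

* the scattering length is finite, `scatteringLength v ≠ ⊤` — the tree theorem
  `Literature.MathematicalPhysics.QuantumManyBody.BoseGas.IsRepulsiveFiniteRange.scatteringLength_ne_top`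
  (LSSY 2005, App. C, Thm. C.1, Remark 2: bump-function trial state in the variational principle);
* if `v` is not a.e. zero on `(0, ∞)`, then `scatteringLength v ≠ 0` — the contrapositive of the
  tree theorem `LSSY2005_zeroScatteringLength_holds` (LSSY 2005, App. C, Thm. C.1 (C.8) and
  Lemma C.2: `a = 0` forces `v(|x|) = 0` for a.e. `x ∈ ℝ³`), carried from `ℝ³` to the radial
  variable by polar coordinates (`lintegral_comp_norm_eq_sphere`:
  `∫ v(|x|) dx = 4π ∫_{(0,∞)} r² v(r) dr`, and `r² > 0` on `(0, ∞)`).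

References: E. H. Lieb, R. Seiringer, J. P. Solovej, J. Yngvason, *The Mathematics of the Bose Gas
and its Condensation* (2005), Appendix C.
-/

noncomputable section

open MeasureTheory Set
open scoped ENNReal

namespace Summit.AtomisticToContinuum.BoseEinsteinCondensation.Theorems

open Literature.MathematicalPhysics.QuantumManyBody.BoseGas

/-- **Radial null-set transfer.** If a measurable `v : ℝ → ℝ≥0∞` has `v(|x|) = 0` for a.e.
`x ∈ ℝ³`, then `v(r) = 0` for a.e. `r ∈ (0, ∞)`: by polar coordinates
`0 = ∫ v(|x|) dx = 4π ∫_{(0,∞)} r² v(r) dr`, and the weight `r²` is positive on `(0, ∞)`.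
[folklore] -/
theorem ae_restrict_Ioi_eq_zero_of_ae_norm_eq_zero {v : ℝ → ℝ≥0∞} (hv : Measurable v)
    (h : ∀ᵐ x : Space, v ‖x‖ = 0) : ∀ᵐ r ∂(volume.restrict (Ioi (0 : ℝ))), v r = 0 := by
  have h3 : ∫⁻ x : Space, v ‖x‖ = 0 := (lintegral_eq_zero_iff (hv.comp measurable_norm)).mpr h
  rw [lintegral_comp_norm_eq_sphere hv] at h3
  have h4 : ∫⁻ r in Ioi (0 : ℝ), ENNReal.ofReal (r ^ 2) * v r = 0 := by
    rcases mul_eq_zero.mp h3 with h | h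
    · exfalso
      rw [ENNReal.ofReal_eq_zero] at h
      linarith [Real.pi_pos]
    · exact h
  have hm : Measurable fun r : ℝ => ENNReal.ofReal (r ^ 2) * v r :=
    ((measurable_id.pow_const 2).ennreal_ofReal).mul hv
  have h5 := (lintegral_eq_zero_iff hm).mp h4
  filter_upwards [h5, ae_restrict_mem measurableSet_Ioi] with r hr hr0
  have hr2 : ENNReal.ofReal (r ^ 2) ≠ 0 := by
    rw [Ne, ENNReal.ofReal_eq_zero, not_le]
    exact pow_pos hr0 2
  exact (mul_eq_zero.mp hr).resolve_left hr2

/-- **Positive scattering length of a genuinely interacting potential.** For a repulsive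
finite-range `v` that is not a.e. zero on `(0, ∞)`, `scatteringLength v ≠ 0`: contrapositive of
`LSSY2005_zeroScatteringLength_holds` (`a = 0 ⇒ v(|x|) = 0` a.e. on `ℝ³`) and the radial transfer
`ae_restrict_Ioi_eq_zero_of_ae_norm_eq_zero`. [cite: LSSY2005, App. C, Thm. C.1 (C.8), Lemma C.2] -/
theorem scatteringLength_ne_zero_of_not_ae_zero {v : ℝ → ℝ≥0∞} (hv : IsRepulsiveFiniteRange v)
    (hne : ¬ (∀ᵐ r ∂(volume.restrict (Ioi (0 : ℝ))), v r = 0)) : scatteringLength v ≠ 0 := by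
  intro h0
  obtain ⟨R₀, hR₀⟩ := hv.2
  exact hne (ae_restrict_Ioi_eq_zero_of_ae_norm_eq_zero hv.1
    (LSSY2005_zeroScatteringLength_holds v R₀ hv.1 hR₀ h0))

/-- **`ScatteringLengthPos` holds** (settles stmt-AtomisticToContinuum-11479, exact route decl of
`BECStoquasticCensoring`): for every repulsive finite-range `v`, `scatteringLength v ≠ ⊤`
(`IsRepulsiveFiniteRange.scatteringLength_ne_top`), and if `v` is not a.e. zero on `(0, ∞)` then
`scatteringLength v ≠ 0` (`scatteringLength_ne_zero_of_not_ae_zero`).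
[cite: LSSY2005, App. C, Thm. C.1, (C.8), Lemma C.2, Remark 2] -/
theorem scatteringLengthPos_proof :
    Summit.AtomisticToContinuum.BoseEinsteinCondensation.Theses.BECStoquasticCensoring.ScatteringLengthPos := by
  unfold Summit.AtomisticToContinuum.BoseEinsteinCondensation.Theses.BECStoquasticCensoring.ScatteringLengthPos
  intro v hv
  exact ⟨hv.scatteringLength_ne_top, scatteringLength_ne_zero_of_not_ae_zero hv⟩

end Summit.AtomisticToContinuum.BoseEinsteinCondensation.Theorems
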